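import Summits.AtomisticToContinuum.HydrodynamicLimit.Theorems.AnnealedZeroHorizonDefs
import Summits.AtomisticToContinuum.HydrodynamicLimit.Theorems.BoxDissipativeWeakStrongLocalGibbsFineScalePos

/-!
# Crux `AnnealedWeakStrong` (stmt-AtomisticToContinuum-9258), line `registered`, stub S1
`stub_timeZeroMeanConvergence` — file B: uniform integrability and per-centre mean convergence

Helper file (lead `prover-line-stmt-AtomisticToContinuum-9258-c1`, stub worker S1):

* `tendsto_lintegral_abs_of_tendsto_measure` — **convergence in probability plus a uniform second-moment
  bound give convergence in mean** (pointwise truncation `|a| ≤ δ + t⁻¹ 𝟙[δ < |a|] + t a²`), lower integrals;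
* **uniform second moments under the local Gibbs measure** of the deviations of the empirical density,
  momentum coordinates and kinetic energy tested against a weight `0 ≤ χ ≤ C`, by conditioning on the
  positions (`LGFS.lintegral_localGibbsMeasure_le_of_vel`; Gaussian block second moments
  `MesoLLN.integral_momCoord_sq`, `MesoLLN.integral_energy_sq_le`);
* **per-centre mean convergence**: a deviation tending to `0` in probability under the local Gibbs laws at
  time `0` (the crux hypothesis `TendstoHydroFieldsAt … 0`, read through `Φ_0 = id` a.e.) tends to `0` in
  mean, with an explicit uniform bound.

The registered helper theorem of this file is `stub_timeZeroMeanDensityDev : Sig.stub_timeZeroMeanDensityDev`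
(the density case).
-/

noncomputable section

open MeasureTheory Filter Set
open scoped ENNReal Topology

namespace Summit.AtomisticToContinuum.HydrodynamicLimit.Theorems.AWS

open Literature.MathematicalPhysics.KineticTheory Literature.Analysis.FluidPDE

/-! ### Uniform integrability: from convergence in probability to convergence in mean -/

/-- The truncation inequality `|a| ≤ t⁻¹ + t a²` (`t > 0`; AM–GM). -/
theorem abs_le_inv_add_mul_sq (a : ℝ) {t : ℝ} (ht : 0 < t) : |a| ≤ t⁻¹ + t * a ^ 2 := by
  have h1 : 0 ≤ t * (|a| - t⁻¹) ^ 2 := by positivity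
  have h2 : t * (|a| - t⁻¹) ^ 2 = t * a ^ 2 - 2 * |a| + t⁻¹ := by
    have : t * t⁻¹ = 1 := mul_inv_cancel₀ ht.ne'
    rw [← sq_abs a]
    field_simp
    ring
  nlinarith [abs_nonneg a, h1, h2]

/-- **The basic uniform-integrability estimate** on a probability space: for `t > 0` and real `δ`,
`E |X| ≤ δ⁺ + t⁻¹ P(δ < |X|) + t E X²` (lower integrals). -/
theorem lintegral_abs_le_trunc {Ω : Type*} [MeasurableSpace Ω] (μ : Measure Ω) [IsProbabilityMeasure μ]
    {X : Ω → ℝ} (hX : Measurable X) (δ : ℝ) {t : ℝ} (ht : 0 < t) :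
    ∫⁻ ω, ENNReal.ofReal |X ω| ∂μ ≤
      ENNReal.ofReal δ + ENNReal.ofReal t⁻¹ * μ {ω | δ < |X ω|} +
        ENNReal.ofReal t * ∫⁻ ω, ENNReal.ofReal (X ω ^ 2) ∂μ := by
  set s : Set Ω := {ω | δ < |X ω|} with hs
  have hsm : MeasurableSet s := measurableSet_lt measurable_const hX.abs
  have hpt : ∀ ω, ENNReal.ofReal |X ω| ≤
      ENNReal.ofReal δ + ENNReal.ofReal t⁻¹ * s.indicator 1 ω + ENNReal.ofReal t * ENNReal.ofReal (X ω ^ 2) := by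
    intro ω
    by_cases hω : δ < |X ω|
    · have hmem : ω ∈ s := hω
      rw [Set.indicator_of_mem hmem, Pi.one_apply, mul_one, add_assoc]
      refine le_add_left ?_
      calc ENNReal.ofReal |X ω| ≤ ENNReal.ofReal (t⁻¹ + t * X ω ^ 2) :=
            ENNReal.ofReal_le_ofReal (abs_le_inv_add_mul_sq (X ω) ht)
        _ = ENNReal.ofReal t⁻¹ + ENNReal.ofReal t * ENNReal.ofReal (X ω ^ 2) := by
            rw [ENNReal.ofReal_add (inv_nonneg.2 ht.le) (by positivity), ENNReal.ofReal_mul ht.le]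
    · exact le_add_right (le_add_right (ENNReal.ofReal_le_ofReal (not_lt.1 hω)))
  have hm1 : Measurable fun ω => ENNReal.ofReal δ + ENNReal.ofReal t⁻¹ * s.indicator 1 ω :=
    ((measurable_one.indicator hsm).const_mul _).const_add _
  calc ∫⁻ ω, ENNReal.ofReal |X ω| ∂μ
      ≤ ∫⁻ ω, (ENNReal.ofReal δ + ENNReal.ofReal t⁻¹ * s.indicator 1 ω +
          ENNReal.ofReal t * ENNReal.ofReal (X ω ^ 2)) ∂μ := lintegral_mono hpt
    _ = ENNReal.ofReal δ + ENNReal.ofReal t⁻¹ * μ s + ENNReal.ofReal t * ∫⁻ ω, ENNReal.ofReal (X ω ^ 2) ∂μ := by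
        rw [lintegral_add_left hm1, lintegral_add_left measurable_const, lintegral_const, measure_univ,
          mul_one, lintegral_const_mul _ (measurable_one.indicator hsm), lintegral_indicator_one hsm,
          lintegral_const_mul _ (hX.pow_const 2).ennreal_ofReal]

/-- **Convergence in probability plus a uniform second-moment bound give convergence in mean**: along
probability spaces `(Ω_N, P_N)`, if `E X_N² ≤ C` and `P_N(δ < |X_N|) → 0` for every `δ > 0`, then
`E |X_N| → 0` (lower integrals). -/
theorem tendsto_lintegral_abs_of_tendsto_measure {Ω : ℕ → Type*} [∀ N, MeasurableSpace (Ω N)]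
    (P : ∀ N, Measure (Ω N)) [∀ N, IsProbabilityMeasure (P N)] (X : ∀ N, Ω N → ℝ)
    (hX : ∀ N, Measurable (X N)) {C : ℝ}
    (h2 : ∀ N, ∫⁻ ω, ENNReal.ofReal (X N ω ^ 2) ∂P N ≤ ENNReal.ofReal C)
    (hP : ∀ δ : ℝ, 0 < δ → Tendsto (fun N => P N {ω | δ < |X N ω|}) atTop (𝓝 0)) :
    Tendsto (fun N => ∫⁻ ω, ENNReal.ofReal |X N ω| ∂P N) atTop (𝓝 0) := by
  rw [ENNReal.tendsto_nhds_zero]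
  intro ε hε
  rcases eq_or_ne ε ⊤ with hεt | hεt
  · exact Eventually.of_forall fun N => hεt ▸ le_top
  have he : 0 < ε.toReal := ENNReal.toReal_pos hε.ne' hεt
  set e := ε.toReal with he_def
  set C' : ℝ := max C 0 + 1 with hC'
  have hC'0 : 0 < C' := by rw [hC']; positivity
  have hCC' : C ≤ C' := by rw [hC']; linarith [le_max_left C 0]
  set t : ℝ := e / 3 / C' with ht_def
  have ht : 0 < t := by rw [ht_def]; positivity
  have htC : t * C' = e / 3 := by rw [ht_def]; field_simp
  have hpos : (0 : ℝ≥0∞) < ENNReal.ofReal (t * (e / 3)) := ENNReal.ofReal_pos.2 (by positivity)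
  filter_upwards [(hP (e / 3) (by positivity)).eventually (ge_mem_nhds hpos)] with N hN
  rw [← ENNReal.ofReal_toReal hεt]
  calc ∫⁻ ω, ENNReal.ofReal |X N ω| ∂P N
      ≤ ENNReal.ofReal (e / 3) + ENNReal.ofReal t⁻¹ * P N {ω | e / 3 < |X N ω|} +
          ENNReal.ofReal t * ∫⁻ ω, ENNReal.ofReal (X N ω ^ 2) ∂P N :=
        lintegral_abs_le_trunc (P N) (hX N) (e / 3) ht
    _ ≤ ENNReal.ofReal (e / 3) + ENNReal.ofReal t⁻¹ * ENNReal.ofReal (t * (e / 3)) +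
          ENNReal.ofReal t * ENNReal.ofReal C' := by
        exact add_le_add (add_le_add le_rfl (mul_le_mul_right hN _))
          (mul_le_mul_right ((h2 N).trans (ENNReal.ofReal_le_ofReal hCC')) _)
    _ = ENNReal.ofReal e := by
        rw [← ENNReal.ofReal_mul (inv_nonneg.2 ht.le), ← mul_assoc, inv_mul_cancel₀ ht.ne', one_mul,
          ← ENNReal.ofReal_mul ht.le, htC, ← ENNReal.ofReal_add (by positivity) (by positivity),
          ← ENNReal.ofReal_add (by positivity) (by positivity)]
        congr 1
        ring

/-- `E |X| ≤ 1 + C` whenever `E X² ≤ C` (probability space, lower integrals). -/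
theorem lintegral_abs_le_one_add {Ω : Type*} [MeasurableSpace Ω] (μ : Measure Ω) [IsProbabilityMeasure μ]
    {X : Ω → ℝ} {C : ℝ} (hC : 0 ≤ C) (h2 : ∫⁻ ω, ENNReal.ofReal (X ω ^ 2) ∂μ ≤ ENNReal.ofReal C) :
    ∫⁻ ω, ENNReal.ofReal |X ω| ∂μ ≤ ENNReal.ofReal (1 + C) := by
  calc ∫⁻ ω, ENNReal.ofReal |X ω| ∂μ ≤ ∫⁻ ω, (1 + ENNReal.ofReal (X ω ^ 2)) ∂μ := by
        refine lintegral_mono fun ω => ?_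
        have h : |X ω| ≤ 1 + X ω ^ 2 := by
          have := abs_le_inv_add_mul_sq (X ω) one_pos
          rwa [inv_one, one_mul] at this
        calc ENNReal.ofReal |X ω| ≤ ENNReal.ofReal (1 + X ω ^ 2) := ENNReal.ofReal_le_ofReal h
          _ = 1 + ENNReal.ofReal (X ω ^ 2) := by
              rw [ENNReal.ofReal_add zero_le_one (sq_nonneg _), ENNReal.ofReal_one]
    _ = 1 + ∫⁻ ω, ENNReal.ofReal (X ω ^ 2) ∂μ := by
        rw [lintegral_add_left measurable_const, lintegral_const, measure_univ, mul_one]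
    _ ≤ 1 + ENNReal.ofReal C := add_le_add le_rfl h2
    _ = ENNReal.ofReal (1 + C) := by rw [ENNReal.ofReal_add zero_le_one hC, ENNReal.ofReal_one]

/-- A pointwise bound on `|X|` bounds the second moment: `E X² ≤ B²` (probability space). -/
theorem lintegral_sq_le_of_abs_le {Ω : Type*} [MeasurableSpace Ω] (μ : Measure Ω) [IsProbabilityMeasure μ]
    {X : Ω → ℝ} {B : ℝ} (hB : ∀ ω, |X ω| ≤ B) :
    ∫⁻ ω, ENNReal.ofReal (X ω ^ 2) ∂μ ≤ ENNReal.ofReal (B ^ 2) := by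
  calc ∫⁻ ω, ENNReal.ofReal (X ω ^ 2) ∂μ ≤ ∫⁻ _ω, ENNReal.ofReal (B ^ 2) ∂μ := by
        refine lintegral_mono fun ω => ENNReal.ofReal_le_ofReal ?_
        rw [← sq_abs (X ω)]
        exact pow_le_pow_left₀ (abs_nonneg _) (hB ω) 2
    _ = ENNReal.ofReal (B ^ 2) := by rw [lintegral_const, measure_univ, mul_one]

/-! ### Averages -/

/-- `|n⁻¹ ∑ᵢ χ(qᵢ) g(qᵢ)| ≤ C G` for `0 ≤ χ ≤ C`, `|g| ≤ G`, `n ≠ 0`. -/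
theorem abs_avg_mul_le {n : ℕ} [NeZero n] {χ g : T3 → ℝ} {C G : ℝ} (hχ0 : ∀ y, 0 ≤ χ y)
    (hχC : ∀ y, χ y ≤ C) (hG : ∀ y, |g y| ≤ G) (q : Fin n → T3) :
    |(n : ℝ)⁻¹ * ∑ i, χ (q i) * g (q i)| ≤ C * G := by
  have hn : 0 ≤ (n : ℝ)⁻¹ := inv_nonneg.2 (Nat.cast_nonneg _)
  have h1 : |(n : ℝ)⁻¹ * ∑ i, χ (q i) * g (q i)| ≤ (n : ℝ)⁻¹ * ∑ i, |χ (q i) * g (q i)| := by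
    rw [abs_mul, abs_of_nonneg hn]
    exact mul_le_mul_of_nonneg_left (Finset.abs_sum_le_sum_abs _ _) hn
  have hb : ∀ y, |χ y * g y| ≤ C * G := fun y => by
    rw [abs_mul, abs_of_nonneg (hχ0 y)]
    exact mul_le_mul (hχC y) (hG y) (abs_nonneg _) ((hχ0 y).trans (hχC y))
  have h2 := LGFS.abs_avg_le (g := fun y => |χ y * g y|) (fun y => abs_nonneg _) hb q
  rw [abs_of_nonneg (LGFS.avg_nonneg (g := fun y => |χ y * g y|) (fun y => abs_nonneg _) q)] at h2
  exact h1.trans h2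

/-- `|empiricalDensityField z χ| ≤ C` for `0 ≤ χ ≤ C` and at least one particle. -/
theorem abs_empiricalDensityField_le {n : ℕ} [NeZero n] {χ : T3 → ℝ} {C : ℝ} (hχ0 : ∀ y, 0 ≤ χ y)
    (hχC : ∀ y, χ y ≤ C) (z : Config n (Fin 3) T3) : |empiricalDensityField z χ| ≤ C := by
  rw [empiricalDensityField_eq_sum]
  exact LGFS.abs_avg_le hχ0 hχC fun i => (z i).1

variable {a₀ θ₀ : T3 → ℝ} {u₀ : T3 → V3}

section PerCentre

variable (ha : Continuous a₀) (hθ : Continuous θ₀) (hu : Continuous u₀) (ha0 : ∀ x, 0 < a₀ x)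
  (hθ0 : ∀ x, 0 < θ₀ x) {σ : ℝ} (hσ2 : σ ≤ 1 / 2)
include ha hθ hu ha0 hθ0 hσ2

/-! ### Uniform second moments under the local Gibbs measure -/

/-- **Momentum coordinate, second moment**: for `0 ≤ χ ≤ C`, `θ₀ ≤ Θ`, `‖u₀‖ ≤ U`, `‖w‖ ≤ W`,
`E_{P_N} ((m̂(χ) - w)ₗ)² ≤ C² Θ + (C U + W)²`. -/
theorem lintegral_momCoord_sq_le (N : ℕ) {χ : T3 → ℝ} (hχ : Measurable χ) {C : ℝ} (hχ0 : ∀ y, 0 ≤ χ y)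
    (hχC : ∀ y, χ y ≤ C) {Θ U W : ℝ} (hΘ : ∀ y, θ₀ y ≤ Θ) (hU : ∀ y, ‖u₀ y‖ ≤ U) {w : V3}
    (hw : ‖w‖ ≤ W) (l : Fin 3) :
    ∫⁻ z, ENNReal.ofReal (((empiricalMomentumField z χ - w) l) ^ 2) ∂localGibbsMeasure σ a₀ u₀ θ₀ N ≤
      ENNReal.ofReal (C ^ 2 * Θ + (C * U + W) ^ 2) := by
  haveI := isProbabilityMeasure_posGibbsMeasure ha ha0 hσ2 N
  have hC0 : 0 ≤ C := (hχ0 0).trans (hχC 0)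
  have hΘ0 : 0 ≤ Θ := (hθ0 0).le.trans (hΘ 0)
  have hcoord : Measurable fun p : V3 => p l := by fun_prop
  have habs : ∀ v : V3, |v l| ≤ ‖v‖ := fun v => by simpa using PiLp.norm_apply_le v l
  have hGm : Measurable fun z : Config (N + 1) (Fin 3) T3 =>
      ENNReal.ofReal (((empiricalMomentumField z χ - w) l) ^ 2) :=
    ((hcoord.comp ((LGFS.measurable_empiricalMomentumField hχ).sub_const w)).pow_const 2).ennreal_ofReal
  have hvel : ∀ q : Fin (N + 1) → T3,
      ∫⁻ v, ENNReal.ofReal (((empiricalMomentumField (zipConfig (q, v)) χ - w) l) ^ 2) ∂velMeasure u₀ θ₀ q ≤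
        ENNReal.ofReal (C ^ 2 * Θ + (C * U + W) ^ 2) := by
    intro q
    have hre : ∀ v : Fin (N + 1) → V3, (empiricalMomentumField (zipConfig (q, v)) χ - w) l =
        (((N + 1 : ℕ) : ℝ))⁻¹ * ∑ i, χ (q i) * v i l - w l := fun v => by
      rw [PiLp.sub_apply, empiricalMomentumField_eq_sum]
      simp only [zipConfig_apply, PiLp.smul_apply, WithLp.ofLp_sum, Finset.sum_apply, smul_eq_mul]
    simp_rw [hre]
    obtain ⟨hint, heq⟩ := MesoLLN.integral_momCoord_sq (u₀ := u₀) hθ0 q (fun i => χ (q i)) (w l) l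
    rw [← ofReal_integral_eq_lintegral_ofReal hint (ae_of_all _ fun v => sq_nonneg _), heq]
    refine ENNReal.ofReal_le_ofReal (add_le_add ?_ ?_)
    · have havg : (((N + 1 : ℕ) : ℝ))⁻¹ * ∑ i, χ (q i) ≤ C :=
        (le_abs_self _).trans (LGFS.abs_avg_le hχ0 hχC q)
      have hn1 : (((N + 1 : ℕ) : ℝ))⁻¹ ≤ 1 := inv_le_one_of_one_le₀ (by exact_mod_cast Nat.succ_pos N)
      calc ∑ i, ((((N + 1 : ℕ) : ℝ))⁻¹ * χ (q i)) ^ 2 * θ₀ (q i)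
          ≤ (((N + 1 : ℕ) : ℝ))⁻¹ * C * Θ * ((((N + 1 : ℕ) : ℝ))⁻¹ * ∑ i, χ (q i)) :=
            LGFS.sum_sq_mul_le (fun i => hχ0 _) (fun i => hχC _) (fun i => (hθ0 _).le) (fun i => hΘ _)
        _ ≤ 1 * C * Θ * C := by
            refine mul_le_mul ?_ havg (LGFS.avg_nonneg hχ0 q) (by positivity)
            exact mul_le_mul_of_nonneg_right (mul_le_mul_of_nonneg_right hn1 hC0) hΘ0
        _ = C ^ 2 * Θ := by ring
    · have h1 : |(((N + 1 : ℕ) : ℝ))⁻¹ * ∑ i, χ (q i) * u₀ (q i) l| ≤ C * U :=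
        abs_avg_mul_le hχ0 hχC (fun y => (habs (u₀ y)).trans (hU y)) q
      have h2 : |w l| ≤ W := (habs w).trans hw
      have h3 : |(((N + 1 : ℕ) : ℝ))⁻¹ * ∑ i, χ (q i) * u₀ (q i) l - w l| ≤ C * U + W :=
        (abs_sub _ _).trans (add_le_add h1 h2)
      exact sq_le_sq' (by linarith [neg_abs_le ((((N + 1 : ℕ) : ℝ))⁻¹ * ∑ i, χ (q i) * u₀ (q i) l - w l)])
        ((le_abs_self _).trans h3)
  calc ∫⁻ z, ENNReal.ofReal (((empiricalMomentumField z χ - w) l) ^ 2) ∂localGibbsMeasure σ a₀ u₀ θ₀ N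
      ≤ ∫⁻ _q, ENNReal.ofReal (C ^ 2 * Θ + (C * U + W) ^ 2) ∂posGibbsMeasure a₀ (hsDiameter σ N) (N + 1) :=
        LGFS.lintegral_localGibbsMeasure_le_of_vel ha hθ hu (fun x => (ha0 x).le) hθ0 σ N hGm
          measurable_const hvel
    _ = ENNReal.ofReal (C ^ 2 * Θ + (C * U + W) ^ 2) := by rw [lintegral_const, measure_univ, mul_one]

/-- **Kinetic energy, second moment**: for `0 ≤ χ ≤ C`, `6 θ₀ |u₀|² + θ₀² K₄/2 ≤ B`,
`|‖u₀‖²/2 + 3θ₀/2| ≤ Ee`, `|c| ≤ W`: `E_{P_N} (Ê(χ) - c)² ≤ C² B + (C Ee + W)²`. -/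
theorem lintegral_energy_sq_le (N : ℕ) {χ : T3 → ℝ} (hχ : Measurable χ) {C : ℝ} (hχ0 : ∀ y, 0 ≤ χ y)
    (hχC : ∀ y, χ y ≤ C) {B Ee W : ℝ}
    (hB : ∀ y, 2 * 3 * θ₀ y * ‖u₀ y‖ ^ 2 + θ₀ y ^ 2 / 2 * gaussFourthMomentConst (Fin 3) ≤ B)
    (hEe : ∀ y, |‖u₀ y‖ ^ 2 / 2 + 3 / 2 * θ₀ y| ≤ Ee) {c : ℝ} (hc : |c| ≤ W) :
    ∫⁻ z, ENNReal.ofReal ((empiricalEnergyField z χ - c) ^ 2) ∂localGibbsMeasure σ a₀ u₀ θ₀ N ≤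
      ENNReal.ofReal (C ^ 2 * B + (C * Ee + W) ^ 2) := by
  haveI := isProbabilityMeasure_posGibbsMeasure ha ha0 hσ2 N
  have hC0 : 0 ≤ C := (hχ0 0).trans (hχC 0)
  have hB0 : 0 ≤ B := (LGFS.energyVarBound_nonneg (u₀ := u₀) hθ0 0).trans (hB 0)
  have hGm : Measurable fun z : Config (N + 1) (Fin 3) T3 => ENNReal.ofReal ((empiricalEnergyField z χ - c) ^ 2) :=
    (((LGFS.measurable_empiricalEnergyField hχ).sub_const c).pow_const 2).ennreal_ofReal
  have hvel : ∀ q : Fin (N + 1) → T3,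
      ∫⁻ v, ENNReal.ofReal ((empiricalEnergyField (zipConfig (q, v)) χ - c) ^ 2) ∂velMeasure u₀ θ₀ q ≤
        ENNReal.ofReal (C ^ 2 * B + (C * Ee + W) ^ 2) := by
    intro q
    have hre : ∀ v : Fin (N + 1) → V3, empiricalEnergyField (zipConfig (q, v)) χ - c =
        (((N + 1 : ℕ) : ℝ))⁻¹ * ∑ i, χ (q i) * (‖v i‖ ^ 2 / 2) - c := fun v => by
      rw [empiricalEnergyField_eq_sum]
      simp only [zipConfig_apply]
    simp_rw [hre]
    obtain ⟨hint, hle⟩ := MesoLLN.integral_energy_sq_le (u₀ := u₀) hθ0 q (fun i => χ (q i)) c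
    rw [← ofReal_integral_eq_lintegral_ofReal hint (ae_of_all _ fun v => sq_nonneg _)]
    refine ENNReal.ofReal_le_ofReal (hle.trans (add_le_add ?_ ?_))
    · have havg : (((N + 1 : ℕ) : ℝ))⁻¹ * ∑ i, χ (q i) ≤ C :=
        (le_abs_self _).trans (LGFS.abs_avg_le hχ0 hχC q)
      have hn1 : (((N + 1 : ℕ) : ℝ))⁻¹ ≤ 1 := inv_le_one_of_one_le₀ (by exact_mod_cast Nat.succ_pos N)
      calc ∑ i, ((((N + 1 : ℕ) : ℝ))⁻¹ * χ (q i)) ^ 2 *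
            (2 * 3 * θ₀ (q i) * ‖u₀ (q i)‖ ^ 2 + θ₀ (q i) ^ 2 / 2 * gaussFourthMomentConst (Fin 3))
          ≤ (((N + 1 : ℕ) : ℝ))⁻¹ * C * B * ((((N + 1 : ℕ) : ℝ))⁻¹ * ∑ i, χ (q i)) :=
            LGFS.sum_sq_mul_le (fun i => hχ0 _) (fun i => hχC _)
              (fun i => LGFS.energyVarBound_nonneg (u₀ := u₀) hθ0 _) (fun i => hB _)
        _ ≤ 1 * C * B * C := by
            refine mul_le_mul ?_ havg (LGFS.avg_nonneg hχ0 q) (by positivity)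
            exact mul_le_mul_of_nonneg_right (mul_le_mul_of_nonneg_right hn1 hC0) hB0
        _ = C ^ 2 * B := by ring
    · have h1 : |(((N + 1 : ℕ) : ℝ))⁻¹ * ∑ i, χ (q i) * (‖u₀ (q i)‖ ^ 2 / 2 + 3 / 2 * θ₀ (q i))| ≤ C * Ee :=
        abs_avg_mul_le (g := fun y => ‖u₀ y‖ ^ 2 / 2 + 3 / 2 * θ₀ y) hχ0 hχC hEe q
      have h3 : |(((N + 1 : ℕ) : ℝ))⁻¹ * ∑ i, χ (q i) * (‖u₀ (q i)‖ ^ 2 / 2 + 3 / 2 * θ₀ (q i)) - c| ≤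
          C * Ee + W := (abs_sub _ _).trans (add_le_add h1 hc)
      exact sq_le_sq'
        (by linarith [neg_abs_le ((((N + 1 : ℕ) : ℝ))⁻¹ * ∑ i, χ (q i) * (‖u₀ (q i)‖ ^ 2 / 2 + 3 / 2 * θ₀ (q i)) - c)])
        ((le_abs_self _).trans h3)
  calc ∫⁻ z, ENNReal.ofReal ((empiricalEnergyField z χ - c) ^ 2) ∂localGibbsMeasure σ a₀ u₀ θ₀ N
      ≤ ∫⁻ _q, ENNReal.ofReal (C ^ 2 * B + (C * Ee + W) ^ 2) ∂posGibbsMeasure a₀ (hsDiameter σ N) (N + 1) :=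
        LGFS.lintegral_localGibbsMeasure_le_of_vel ha hθ hu (fun x => (ha0 x).le) hθ0 σ N hGm
          measurable_const hvel
    _ = ENNReal.ofReal (C ^ 2 * B + (C * Ee + W) ^ 2) := by rw [lintegral_const, measure_univ, mul_one]

/-! ### Per-centre mean convergence from convergence in probability -/

variable (Φ : (N : ℕ) → HardSphereFlow (Literature.Analysis.FluidPDE.Torus.geometry (Fin 3)) (hsDiameter σ N) (N + 1))

/-- **Density, per centre**: convergence in probability of `ρ̂_N(χ) - I` under the local Gibbs laws at time
`0` upgrades to convergence in mean, with the uniform bound `E|ρ̂_N(χ) - I| ≤ 1 + (C + W)²` (`|I| ≤ W`). -/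
theorem tendsto_lintegral_density_dev {χ : T3 → ℝ} (hχ : Continuous χ) {C : ℝ} (hχ0 : ∀ y, 0 ≤ χ y)
    (hχC : ∀ y, χ y ≤ C) {I W : ℝ} (hI : |I| ≤ W)
    (hP : ∀ δ : ℝ, 0 < δ → Tendsto (fun N => localGibbsLaw σ a₀ u₀ θ₀ N (Φ N)
      {z | δ < |empiricalDensityField ((Φ N).flow 0 z) χ - I|}) atTop (𝓝 0)) :
    Tendsto (fun N => ∫⁻ z, ENNReal.ofReal |empiricalDensityField z χ - I| ∂localGibbsMeasure σ a₀ u₀ θ₀ N)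
        atTop (𝓝 0) ∧
      ∀ N, ∫⁻ z, ENNReal.ofReal |empiricalDensityField z χ - I| ∂localGibbsMeasure σ a₀ u₀ θ₀ N ≤
        ENNReal.ofReal (1 + (C + W) ^ 2) := by
  haveI : ∀ N, IsProbabilityMeasure (localGibbsMeasure σ a₀ u₀ θ₀ N) := fun N =>
    isProbabilityMeasure_localGibbsMeasure ha hθ hu ha0 hθ0 hσ2 N
  have hXm : ∀ N, Measurable fun z : Config (N + 1) (Fin 3) T3 => empiricalDensityField z χ - I := fun N =>
    (LGFS.measurable_empiricalDensityField hχ.measurable).sub_const I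
  have h2 : ∀ N, ∫⁻ z, ENNReal.ofReal ((empiricalDensityField z χ - I) ^ 2) ∂localGibbsMeasure σ a₀ u₀ θ₀ N ≤
      ENNReal.ofReal ((C + W) ^ 2) := fun N =>
    lintegral_sq_le_of_abs_le _ fun z =>
      (abs_sub _ _).trans (add_le_add (abs_empiricalDensityField_le hχ0 hχC z) hI)
  have hP' : ∀ δ : ℝ, 0 < δ → Tendsto (fun N => localGibbsMeasure σ a₀ u₀ θ₀ N
      {z | δ < |empiricalDensityField z χ - I|}) atTop (𝓝 0) := fun δ hδ =>
    (hP δ hδ).congr fun N => localGibbsLaw_preimage_flow_zero σ a₀ u₀ θ₀ N (Φ N)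
      {w | δ < |empiricalDensityField w χ - I|}
  exact ⟨tendsto_lintegral_abs_of_tendsto_measure (Ω := fun N => Config (N + 1) (Fin 3) T3)
      (fun N => localGibbsMeasure σ a₀ u₀ θ₀ N) (fun N z => empiricalDensityField z χ - I) hXm h2 hP',
    fun N => lintegral_abs_le_one_add _ (sq_nonneg _) (h2 N)⟩

/-- **Momentum coordinate, per centre**: convergence in probability of `m̂_N(χ) - I` (in norm) under the local
Gibbs laws at time `0` upgrades, coordinatewise, to convergence in mean, with the uniform bound
`E|(m̂_N(χ) - I)ₗ| ≤ 1 + C²Θ + (C U + W)²` (`‖I‖ ≤ W`). -/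
theorem tendsto_lintegral_momCoord_dev {χ : T3 → ℝ} (hχ : Continuous χ) {C : ℝ} (hχ0 : ∀ y, 0 ≤ χ y)
    (hχC : ∀ y, χ y ≤ C) {Θ U W : ℝ} (hΘ : ∀ y, θ₀ y ≤ Θ) (hU : ∀ y, ‖u₀ y‖ ≤ U) {I : V3} (hI : ‖I‖ ≤ W)
    (hP : ∀ δ : ℝ, 0 < δ → Tendsto (fun N => localGibbsLaw σ a₀ u₀ θ₀ N (Φ N)
      {z | δ < ‖empiricalMomentumField ((Φ N).flow 0 z) χ - I‖}) atTop (𝓝 0)) (l : Fin 3) :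
    Tendsto (fun N => ∫⁻ z, ENNReal.ofReal |(empiricalMomentumField z χ - I) l| ∂localGibbsMeasure σ a₀ u₀ θ₀ N)
        atTop (𝓝 0) ∧
      ∀ N, ∫⁻ z, ENNReal.ofReal |(empiricalMomentumField z χ - I) l| ∂localGibbsMeasure σ a₀ u₀ θ₀ N ≤
        ENNReal.ofReal (1 + (C ^ 2 * Θ + (C * U + W) ^ 2)) := by
  haveI : ∀ N, IsProbabilityMeasure (localGibbsMeasure σ a₀ u₀ θ₀ N) := fun N =>
    isProbabilityMeasure_localGibbsMeasure ha hθ hu ha0 hθ0 hσ2 N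
  have hΘ0 : 0 ≤ Θ := (hθ0 0).le.trans (hΘ 0)
  have hcoord : Measurable fun p : V3 => p l := by fun_prop
  have hXm : ∀ N, Measurable fun z : Config (N + 1) (Fin 3) T3 => (empiricalMomentumField z χ - I) l := fun N =>
    hcoord.comp ((LGFS.measurable_empiricalMomentumField hχ.measurable).sub_const I)
  have h2 : ∀ N, ∫⁻ z, ENNReal.ofReal (((empiricalMomentumField z χ - I) l) ^ 2) ∂localGibbsMeasure σ a₀ u₀ θ₀ N ≤
      ENNReal.ofReal (C ^ 2 * Θ + (C * U + W) ^ 2) := fun N =>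
    lintegral_momCoord_sq_le ha hθ hu ha0 hθ0 hσ2 N hχ.measurable hχ0 hχC hΘ hU hI l
  have hP' : ∀ δ : ℝ, 0 < δ → Tendsto (fun N => localGibbsMeasure σ a₀ u₀ θ₀ N
      {z | δ < |(empiricalMomentumField z χ - I) l|}) atTop (𝓝 0) := by
    intro δ hδ
    have h := (hP δ hδ).congr fun N => localGibbsLaw_preimage_flow_zero σ a₀ u₀ θ₀ N (Φ N)
      {w | δ < ‖empiricalMomentumField w χ - I‖}
    refine tendsto_of_tendsto_of_tendsto_of_le_of_le tendsto_const_nhds h (fun N => zero_le) fun N => ?_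
    exact measure_mono fun z hz =>
      lt_of_lt_of_le hz (by simpa using PiLp.norm_apply_le (empiricalMomentumField z χ - I) l)
  exact ⟨tendsto_lintegral_abs_of_tendsto_measure (Ω := fun N => Config (N + 1) (Fin 3) T3)
      (fun N => localGibbsMeasure σ a₀ u₀ θ₀ N) (fun N z => (empiricalMomentumField z χ - I) l) hXm h2 hP',
    fun N => lintegral_abs_le_one_add _ (by positivity) (h2 N)⟩

/-- **Kinetic energy, per centre**: convergence in probability of `Ê_N(χ) - c` under the local Gibbs laws at
time `0` upgrades to convergence in mean, with the uniform bound `E|Ê_N(χ) - c| ≤ 1 + C²B + (C Ee + W)²`. -/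
theorem tendsto_lintegral_energy_dev {χ : T3 → ℝ} (hχ : Continuous χ) {C : ℝ} (hχ0 : ∀ y, 0 ≤ χ y)
    (hχC : ∀ y, χ y ≤ C) {B Ee W : ℝ}
    (hB : ∀ y, 2 * 3 * θ₀ y * ‖u₀ y‖ ^ 2 + θ₀ y ^ 2 / 2 * gaussFourthMomentConst (Fin 3) ≤ B)
    (hEe : ∀ y, |‖u₀ y‖ ^ 2 / 2 + 3 / 2 * θ₀ y| ≤ Ee) {c : ℝ} (hc : |c| ≤ W)
    (hP : ∀ δ : ℝ, 0 < δ → Tendsto (fun N => localGibbsLaw σ a₀ u₀ θ₀ N (Φ N)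
      {z | δ < |empiricalEnergyField ((Φ N).flow 0 z) χ - c|}) atTop (𝓝 0)) :
    Tendsto (fun N => ∫⁻ z, ENNReal.ofReal |empiricalEnergyField z χ - c| ∂localGibbsMeasure σ a₀ u₀ θ₀ N)
        atTop (𝓝 0) ∧
      ∀ N, ∫⁻ z, ENNReal.ofReal |empiricalEnergyField z χ - c| ∂localGibbsMeasure σ a₀ u₀ θ₀ N ≤
        ENNReal.ofReal (1 + (C ^ 2 * B + (C * Ee + W) ^ 2)) := by
  haveI : ∀ N, IsProbabilityMeasure (localGibbsMeasure σ a₀ u₀ θ₀ N) := fun N =>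
    isProbabilityMeasure_localGibbsMeasure ha hθ hu ha0 hθ0 hσ2 N
  have hB0 : 0 ≤ B := (LGFS.energyVarBound_nonneg (u₀ := u₀) hθ0 0).trans (hB 0)
  have hXm : ∀ N, Measurable fun z : Config (N + 1) (Fin 3) T3 => empiricalEnergyField z χ - c := fun N =>
    (LGFS.measurable_empiricalEnergyField hχ.measurable).sub_const c
  have h2 : ∀ N, ∫⁻ z, ENNReal.ofReal ((empiricalEnergyField z χ - c) ^ 2) ∂localGibbsMeasure σ a₀ u₀ θ₀ N ≤
      ENNReal.ofReal (C ^ 2 * B + (C * Ee + W) ^ 2) := fun N =>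
    lintegral_energy_sq_le ha hθ hu ha0 hθ0 hσ2 N hχ.measurable hχ0 hχC hB hEe hc
  have hP' : ∀ δ : ℝ, 0 < δ → Tendsto (fun N => localGibbsMeasure σ a₀ u₀ θ₀ N
      {z | δ < |empiricalEnergyField z χ - c|}) atTop (𝓝 0) := fun δ hδ =>
    (hP δ hδ).congr fun N => localGibbsLaw_preimage_flow_zero σ a₀ u₀ θ₀ N (Φ N)
      {w | δ < |empiricalEnergyField w χ - c|}
  exact ⟨tendsto_lintegral_abs_of_tendsto_measure (Ω := fun N => Config (N + 1) (Fin 3) T3)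
      (fun N => localGibbsMeasure σ a₀ u₀ θ₀ N) (fun N z => empiricalEnergyField z χ - c) hXm h2 hP',
    fun N => lintegral_abs_le_one_add _ (by positivity) (h2 N)⟩

end PerCentre

/-! ### The registered helper theorem of this file -/

/-- **Signature of the registered helper `stub_timeZeroMeanDensityDev`** (S1, file B): for continuous
profiles `a₀, θ₀ > 0`, `u₀`, `σ ≤ 1/2`, a continuous weight `0 ≤ χ ≤ C` and a target `I`, convergence in
probability of the empirical density deviation `ρ̂_N(χ) - I` under the local Gibbs laws at time `0` implies
its convergence in mean under the local Gibbs measures. -/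
def Sig.stub_timeZeroMeanDensityDev : Prop :=
  ∀ (a₀ θ₀ : T3 → ℝ) (u₀ : T3 → V3), Continuous a₀ → Continuous θ₀ → Continuous u₀ →
    (∀ x, 0 < a₀ x) → (∀ x, 0 < θ₀ x) → ∀ σ : ℝ, σ ≤ 1 / 2 →
    ∀ (Φ : (N : ℕ) → HardSphereFlow (Literature.Analysis.FluidPDE.Torus.geometry (Fin 3)) (hsDiameter σ N) (N + 1))
      (χ : T3 → ℝ) (C I : ℝ), Continuous χ → (∀ y, 0 ≤ χ y) → (∀ y, χ y ≤ C) →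
      (∀ δ : ℝ, 0 < δ → Tendsto (fun N => localGibbsLaw σ a₀ u₀ θ₀ N (Φ N)
        {z | δ < |empiricalDensityField ((Φ N).flow 0 z) χ - I|}) atTop (𝓝 0)) →
      Tendsto (fun N => ∫⁻ z, ENNReal.ofReal |empiricalDensityField z χ - I| ∂localGibbsMeasure σ a₀ u₀ θ₀ N)
        atTop (𝓝 0)

/-- **Registered helper `stub_timeZeroMeanDensityDev`** (S1, file B): the density case of the per-centre
mean convergence, `Sig.stub_timeZeroMeanDensityDev`. -/
theorem stub_timeZeroMeanDensityDev : Sig.stub_timeZeroMeanDensityDev :=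
  fun _ _ _ ha hθ hu ha0 hθ0 _ hσ2 Φ _ _ _ hχ hχ0 hχC hP =>
    (tendsto_lintegral_density_dev ha hθ hu ha0 hθ0 hσ2 Φ hχ hχ0 hχC le_rfl hP).1

end Summit.AtomisticToContinuum.HydrodynamicLimit.Theorems.AWS

end
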